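import Summits.QuantumFields.YangMills.Theorems.BalabanUVNodesN21GappedCollarDesignIJunction
import Summits.QuantumFields.YangMills.Theorems.BalabanUVNodesN21GappedTopReading13CoPHDefs
import Summits.QuantumFields.YangMills.Theorems.BalabanUVNodesN21GappedTopCutDials

/-!
# N21 (NE7c) · THE X-15 DEVICE AT def-T's (3.2) FACTOR FROM TWO-RUN CLOSENESS OF THE LOCAL BACKGROUNDS (the consumer's closeness input, typed as a located shape):
# `χf^A_θ(c)(V_A) ≤ χf^B_{θ+Δ}(c′)(V_B)` whenever every tested plaquette of run B's cube `c′` is dominated, in threshold units, by some tested plaquette of run A's cube `c` up to `Δ`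

Track A of `YM-PLAN.md` (cell `pub-ymgap`, HUMAN RULING D-0062 ∕ D-0149 width seats), node **N21** (NE7c, NOT PRINTED); WIDTH SEAT `pub-ymgap-dag-n21-w2` (gen 3), file 3.
THEOREMS ONLY: 0 `def`, 0 `sorry`; COUNT-NEUTRAL; `--kind proof --supports stmt-QuantumFields-27366 --as helper` (K3⁸ `SpineGivenEndpointR13SepCoPHV`, dag-lead KEY MAP v2 2026-08-28 10:04Z; files 1–2 of this seat were keyed K3⁷ 20544 before the re-key and stay valid under the MIS-KEY rule).  Imports this seat's file 1 `…N21GappedCollarDesignIJunction`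
(p622196 ✓; through it dag-n21-d's `…GappedTopCut13CoPH{,Defs}` and def-T FILE 19 `Node00/StepWeightsAtThresholds`: `chiFactorAt`, `aWeightAt`, `Iχ`, `sideχ`, `cubes32`; def-R's
`cubeEnl`, `plaqInside`, `ukBox`, `bgOfRecord`, `avOfRecord`; `Setup`'s `chiSmall`, `PlaqSmallOn`, `GaugeGroup.dist1`, `Params.eta`) and dag-n21-d's U5 `…GappedTopReading13CoPHDefs`
(p620791 ✓: `selGapDepth₁₃`, `selGapDepth₁₃_le`) and this seat's file 2 `…N21GappedTopCutDials` (`collar_rows_of_dials`).  No Theses import; restates nothing.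

WHY.  This seat's `…N21GappedCollarDesignIJunction` (file 1) reduces design (i)'s shells to dag-n21-d's gapped shells GIVEN, per χ_{k+1}-cube `c` of run A, the two X-15 DEVICES
`χf^A_{θ′}(c)(V_A) ≤ χB c (θ′ + Δ)` and `χB c θ′ ≤ χf^A_{θ′+Δ}(c)(V_A)` for run B's factor family `χB` read through the consumer's site identification `ι`.  With `χB c θ′ :=
chiFactorAt (run B's data) θ′ (ι c) V_B`, each device is the indicator-level shadow of ONE located input: the two runs' LOCAL BACKGROUNDS (2.16) have `Δ`-close plaquette
variables IN THRESHOLD UNITS on corresponding tested plaquettes — N16's two-run closeness (NE3 species; NOT PRINTED: [III] constructs one run; [B11] prints η-uniform regularity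
of ONE background), here DISPLAYED as a plaquette-wise domination hypothesis between `plaqInside (□′^∼)` of the two cubes.  THIS FILE types that shadow: §1 the generic device for
`Setup.chiSmall` across two lattices and two scales; §2 the device at def-T's `chiFactorAt` between two run data `(p, g, k)` and `(p′, g′, k′)` of one family, both directions, and the
family form over a site identification `ι : Iχ^A → Iχ^B` — exactly the `hdevAB ∕ hdevBA` binders of file 1's ★★★ `aWeightAt_sub_core_le_aWeightAt_sub_aGapAt_of_device`.

WHAT IS PROVED ([folklore] ∕ [bookkeeping]).
* §1 `plaqSmallOn_of_dominated` · ★ `chiSmall_le_chiSmall_of_dominated` (two lattices, thresholds `θ·a` and `(θ+Δ)·a′`, `0 < a′`: plaquette-wise domination in units `a, a′` ⇒ device).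
* §2 ★★ `chiFactorAt_le_chiFactorAt_add_of_bgDominated` (run A at `θ` ≤ run B at `θ + Δ`) · ★★ family forms `device_AB_of_bgClose` ∕ `device_BA_of_bgClose` over `ι`
  (the two binders of file 1 §2c, from the symmetric two-run closeness hypothesis written inline — no `def`).
* §3 ★★★ `aWeightAt_sub_core_le_aWeightAt_sub_aGapAt_of_bgClose` — file 1 §2c ∘ §2: at run A's top field `V`, label `P ⊆ cubes32 s`, collar `θlo + Δ ≤ θ ≤ θhi − Δ`, `0 ≤ Δ`, and the two-way
  background closeness through `ι`: design (i)'s deficit of def-T's `a|_θ(P)(V)` against run B's factors `χf^B_θ(ι c)(V′)` is at most dag-n21-d's gapped deficit `a|_θ(P)(V) − aGapAt θlo θhi s P V`.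
* §3b `eq_one_of_prod_ge_one` · ★★ `top_factors_agree_on_gapped_support` — same hypotheses + `aGapAt θlo θhi s P V ≠ 0`: on the support of run A's GAPPED weight, run B's top (3.2)
  factors at `θ` through `ι` EQUAL run A's (`= 1` off `P`, `= 0` on `P`) — the «identical indicator sets» premise of N19′'s core sandwich, PRODUCED (the sandwich itself = NE7 proper, NOT here).
* §4 ★★ `collar_rows_at_selGapDepth_A ∕ _B` — at dag-n21-d's SELECTED depth `i⋆ = selGapDepth₁₃ … ≤ n_K` (U5 p620791 `selGapDepth₁₃_le`) the three letters of
  `gapShellA₁₃ ∕ gapShellB₁₃` clear `ε δ_K` on both sides and lie in `[ε/2, ε]`, from the dials' rows at `K` (companion `…GappedTopCutDials.exists_dials_of_summable`).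

HONEST FRAMING.  The domination ∕ closeness hypotheses are DISPLAYED, inhabited for no family here (they are N16's output at the indicator's scale, NOT PRINTED); the local backgrounds
`ukBox (bgOfRecord …)` are def-R's pins read BY NAME, nothing about them is proved; nothing of Bałaban's asserted; NE7c NOT PRINTED ∕ NOT proved; **N21 NOT discharged**; K3⁷ ∕ K3⁸ NOT claimed;
counts UNMOVED (typed 28∕28 · discharged 5∕27); never a count claim.  One finite four-torus programme at fixed `ε` — NOT ℝ⁴, NOT OS, NOT a mass gap, NOT the Clay problem.  No decl
below carries a cite tag.
-/

namespace Summit.QuantumFields.YangMills.Theorems.N21TwoRunDevice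

open Literature.MathematicalPhysics.QuantumFieldTheory.Balaban1983to89
open Literature.MathematicalPhysics.QuantumFieldTheory.Balaban1983to89.T4Continuum
open Literature.MathematicalPhysics.QuantumFieldTheory.Balaban1983to89.Node00
open B14.Eq216Concrete (ukBox)
open GaugeField (plaqHol)
open GaugeGroup (dist1)

/-! ## §1 The device for `chiSmall` across two lattices and two scales -/

section Generic

variable {P P' : Params} {j j' : ℕ} {G : Type*} [GaugeGroup G]

/-- Plaquette-wise domination in units `a, a′` (`0 < a′`) transports smallness: if every `p′ ∈ S′` has some `p ∈ S` with `|U′(∂p′) − 1|∕a′ ≤ |U(∂p) − 1|∕a + Δ`, then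
«`U` small on `S` at `θ·a`» gives «`U′` small on `S′` at `(θ + Δ)·a′`». [folklore] -/
theorem plaqSmallOn_of_dominated {S : Set (Plaq P j)} {S' : Set (Plaq P' j')} {a a' θ Δ : ℝ} (ha : 0 < a) (ha' : 0 < a')
    {U : GaugeField P j G} {U' : GaugeField P' j' G}
    (h : ∀ p' ∈ S', ∃ p ∈ S, dist1 (plaqHol U' p') / a' ≤ dist1 (plaqHol U p) / a + Δ)
    (hU : PlaqSmallOn S (θ * a) U) : PlaqSmallOn S' ((θ + Δ) * a') U' := by
  intro p' hp'
  obtain ⟨p, hp, hdom⟩ := h p' hp'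
  have h1 : dist1 (plaqHol U p) / a < θ := by
    rw [div_lt_iff₀ ha]; exact hU p hp
  have h2 : dist1 (plaqHol U' p') / a' < θ + Δ := by linarith
  rwa [div_lt_iff₀ ha'] at h2

/-- ★ **THE X-15 DEVICE FOR `chiSmall` ACROSS TWO LATTICES ∕ SCALES**: under the plaquette-wise domination of `plaqSmallOn_of_dominated`,
`chiSmall S (θ·a) U ≤ chiSmall S′ ((θ + Δ)·a′) U′`. [folklore] -/
theorem chiSmall_le_chiSmall_of_dominated {S : Set (Plaq P j)} {S' : Set (Plaq P' j')} {a a' θ Δ : ℝ} (ha : 0 < a) (ha' : 0 < a')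
    {U : GaugeField P j G} {U' : GaugeField P' j' G}
    (h : ∀ p' ∈ S', ∃ p ∈ S, dist1 (plaqHol U' p') / a' ≤ dist1 (plaqHol U p) / a + Δ) :
    chiSmall S (θ * a) U ≤ chiSmall S' ((θ + Δ) * a') U' := by
  classical
  by_cases hU : PlaqSmallOn S (θ * a) U
  · have hU' := plaqSmallOn_of_dominated ha ha' h hU
    simp only [chiSmall, if_pos hU, if_pos hU', le_refl]
  · simp only [chiSmall, if_neg hU]
    split_ifs <;> norm_num

end Generic

/-! ## §2 The device at def-T's (3.2) factor between two run data of one family -/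

section AtFactor

variable (F : T4Family) (N : ℕ) [NeZero N] (ν : Stage7Numerics)

/-- ★★ **THE DEVICE AT def-T's (3.2) FACTOR.**  Two run data `(p, g, k)` (run A) and `(p′, g′, k′)` (run B) of one family, χ_{k+1}-cubes `c` and `c′`, top fields `V` and `V′`: if every tested
plaquette `q′ ⊂ c′^∼` of run B's local background `U_{k′+1,c′}(V′)` is dominated IN THRESHOLD UNITS (`η_{k′+1}²` resp. `η_{k+1}²`) by some tested plaquette `q ⊂ c^∼` of run A's
`U_{k+1,c}(V)` up to `Δ` — the located two-run closeness input, DISPLAYED — then `χf^A_θ(c)(V) ≤ χf^B_{θ+Δ}(c′)(V′)`. [bookkeeping] -/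
theorem chiFactorAt_le_chiFactorAt_add_of_bgDominated {p p' : B12.RunParams} {g g' : ℕ → ℝ} {k k' : ℕ} (c : Iχ F ν p g k) (c' : Iχ F ν p' g' k')
    (V : GaugeField (F.P p.K) (k + 1) (SU N)) (V' : GaugeField (F.P p'.K) (k' + 1) (SU N)) {θ Δ : ℝ}
    (h : ∀ q' ∈ plaqInside (cubeEnl (F.P p'.K) (sideχ F ν p' g' k') c' 1), ∃ q ∈ plaqInside (cubeEnl (F.P p.K) (sideχ F ν p g k) c 1),
      dist1 (plaqHol (ukBox (bgOfRecord (avOfRecord F N p'.K) {U | PlaqSmall (ν.εreg * (F.P p'.K).eta (k' + 1) ^ 2) U}) ν.M₁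
          (cubeEnl (F.P p'.K) (sideχ F ν p' g' k') c' 4) (k' + 1) V') q') / (F.P p'.K).eta (k' + 1) ^ 2 ≤
        dist1 (plaqHol (ukBox (bgOfRecord (avOfRecord F N p.K) {U | PlaqSmall (ν.εreg * (F.P p.K).eta (k + 1) ^ 2) U}) ν.M₁
          (cubeEnl (F.P p.K) (sideχ F ν p g k) c 4) (k + 1) V) q) / (F.P p.K).eta (k + 1) ^ 2 + Δ) :
    chiFactorAt F N ν p g k θ c V ≤ chiFactorAt F N ν p' g' k' (θ + Δ) c' V' := by
  unfold chiFactorAt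
  -- `0 < η = L^{-j}` on both tori (`Params.L_pos`), inlined (the one-line fact is landed elsewhere as `…BIJ85Sigma422Eta.eta_pos`; not imported here)
  exact chiSmall_le_chiSmall_of_dominated (pow_pos (pow_pos (inv_pos.2 (by exact_mod_cast (F.P p.K).L_pos)) (k + 1)) 2)
    (pow_pos (pow_pos (inv_pos.2 (by exact_mod_cast (F.P p'.K).L_pos)) (k' + 1)) 2) h

/-- ★★ **FAMILY FORM, DIRECTION A → B** (file 1 §2c's binder `hdevAB` with `χB c θ′ := χf^B_{θ′}(ι c)(V′)`): along a site identification `ι : Iχ^A → Iχ^B`, the A→B domination at EVERY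
letter (i.e. closeness in threshold units, a LETTER-FREE statement) gives `∀ c θ′, χf^A_{θ′}(c)(V) ≤ χf^B_{θ′+Δ}(ι c)(V′)`. [bookkeeping] -/
theorem device_AB_of_bgClose {p p' : B12.RunParams} {g g' : ℕ → ℝ} {k k' : ℕ} (ι : Iχ F ν p g k → Iχ F ν p' g' k')
    (V : GaugeField (F.P p.K) (k + 1) (SU N)) (V' : GaugeField (F.P p'.K) (k' + 1) (SU N)) {Δ : ℝ}
    (hAB : ∀ c : Iχ F ν p g k, ∀ q' ∈ plaqInside (cubeEnl (F.P p'.K) (sideχ F ν p' g' k') (ι c) 1), ∃ q ∈ plaqInside (cubeEnl (F.P p.K) (sideχ F ν p g k) c 1),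
      dist1 (plaqHol (ukBox (bgOfRecord (avOfRecord F N p'.K) {U | PlaqSmall (ν.εreg * (F.P p'.K).eta (k' + 1) ^ 2) U}) ν.M₁
          (cubeEnl (F.P p'.K) (sideχ F ν p' g' k') (ι c) 4) (k' + 1) V') q') / (F.P p'.K).eta (k' + 1) ^ 2 ≤
        dist1 (plaqHol (ukBox (bgOfRecord (avOfRecord F N p.K) {U | PlaqSmall (ν.εreg * (F.P p.K).eta (k + 1) ^ 2) U}) ν.M₁
          (cubeEnl (F.P p.K) (sideχ F ν p g k) c 4) (k + 1) V) q) / (F.P p.K).eta (k + 1) ^ 2 + Δ) :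
    ∀ (c : Iχ F ν p g k) (θ' : ℝ), chiFactorAt F N ν p g k θ' c V ≤ chiFactorAt F N ν p' g' k' (θ' + Δ) (ι c) V' :=
  fun c _ => chiFactorAt_le_chiFactorAt_add_of_bgDominated F N ν c (ι c) V V' (hAB c)

/-- ★★ **FAMILY FORM, DIRECTION B → A** (file 1 §2c's binder `hdevBA`): the B→A domination along `ι` gives `∀ c θ′, χf^B_{θ′}(ι c)(V′) ≤ χf^A_{θ′+Δ}(c)(V)`. [bookkeeping] -/
theorem device_BA_of_bgClose {p p' : B12.RunParams} {g g' : ℕ → ℝ} {k k' : ℕ} (ι : Iχ F ν p g k → Iχ F ν p' g' k')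
    (V : GaugeField (F.P p.K) (k + 1) (SU N)) (V' : GaugeField (F.P p'.K) (k' + 1) (SU N)) {Δ : ℝ}
    (hBA : ∀ c : Iχ F ν p g k, ∀ q ∈ plaqInside (cubeEnl (F.P p.K) (sideχ F ν p g k) c 1), ∃ q' ∈ plaqInside (cubeEnl (F.P p'.K) (sideχ F ν p' g' k') (ι c) 1),
      dist1 (plaqHol (ukBox (bgOfRecord (avOfRecord F N p.K) {U | PlaqSmall (ν.εreg * (F.P p.K).eta (k + 1) ^ 2) U}) ν.M₁
          (cubeEnl (F.P p.K) (sideχ F ν p g k) c 4) (k + 1) V) q) / (F.P p.K).eta (k + 1) ^ 2 ≤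
        dist1 (plaqHol (ukBox (bgOfRecord (avOfRecord F N p'.K) {U | PlaqSmall (ν.εreg * (F.P p'.K).eta (k' + 1) ^ 2) U}) ν.M₁
          (cubeEnl (F.P p'.K) (sideχ F ν p' g' k') (ι c) 4) (k' + 1) V') q') / (F.P p'.K).eta (k' + 1) ^ 2 + Δ) :
    ∀ (c : Iχ F ν p g k) (θ' : ℝ), chiFactorAt F N ν p' g' k' θ' (ι c) V' ≤ chiFactorAt F N ν p g k (θ' + Δ) c V :=
  fun c _ => chiFactorAt_le_chiFactorAt_add_of_bgDominated F N ν (ι c) c V' V (hBA c)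

end AtFactor

/-! ## §3 The composed junction: from background closeness through `ι` to «design (i)'s (3.2) deficit ≤ dag-n21-d's gapped deficit» -/

section Junction

open Summit.QuantumFields.YangMills.Theorems.N21ShellSplitOfRecord13CoPH (aGapAt)
open Summit.QuantumFields.YangMills.Theorems.N21GappedCollarDesignI (aWeightAt_sub_core_le_aWeightAt_sub_aGapAt_of_device aGapAt_le_core_of_device)
open scoped BigOperators

variable (F : T4Family) (N : ℕ) [NeZero N] (ν : Stage7Numerics) (M : ℕ)

/-- ★★★ **THE JUNCTION FROM TWO-RUN BACKGROUND CLOSENESS.**  Run A's data `(p, g, k)`, top field `V`, (3.2) history `s` and label `P ⊆ cubes32 s`; run B's data `(p′, g′, k′)`, top field `V′`;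
a site identification `ι : Iχ^A → Iχ^B`; the two-way plaquette-wise domination of the LOCAL BACKGROUNDS in threshold units up to `Δ ≥ 0` (N16's closeness at the indicator's scale —
DISPLAYED); a collar `θlo + Δ ≤ θ ≤ θhi − Δ`.  Then design (i)'s deficit of def-T's `a|_θ(P)(V)` against run B's factors read through `ι` is at most dag-n21-d's gapped deficit:
`a|_θ(P)(V) − ∏_{cubes32 s∖P}(χf^A_θ(c)χf^B_θ(ιc)) · ∏_P((1−χf^A_θ(c))(1−χf^B_θ(ιc))) ≤ a|_θ(P)(V) − aGapAt θlo θhi s P V`. [bookkeeping] -/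
theorem aWeightAt_sub_core_le_aWeightAt_sub_aGapAt_of_bgClose {p p' : B12.RunParams} {g g' : ℕ → ℝ} {k k' : ℕ} (ι : Iχ F ν p g k → Iχ F ν p' g' k')
    (V : GaugeField (F.P p.K) (k + 1) (SU N)) (V' : GaugeField (F.P p'.K) (k' + 1) (SU N)) {Δ : ℝ} (hΔ : 0 ≤ Δ)
    (hAB : ∀ c : Iχ F ν p g k, ∀ q' ∈ plaqInside (cubeEnl (F.P p'.K) (sideχ F ν p' g' k') (ι c) 1), ∃ q ∈ plaqInside (cubeEnl (F.P p.K) (sideχ F ν p g k) c 1),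
      dist1 (plaqHol (ukBox (bgOfRecord (avOfRecord F N p'.K) {U | PlaqSmall (ν.εreg * (F.P p'.K).eta (k' + 1) ^ 2) U}) ν.M₁
          (cubeEnl (F.P p'.K) (sideχ F ν p' g' k') (ι c) 4) (k' + 1) V') q') / (F.P p'.K).eta (k' + 1) ^ 2 ≤
        dist1 (plaqHol (ukBox (bgOfRecord (avOfRecord F N p.K) {U | PlaqSmall (ν.εreg * (F.P p.K).eta (k + 1) ^ 2) U}) ν.M₁
          (cubeEnl (F.P p.K) (sideχ F ν p g k) c 4) (k + 1) V) q) / (F.P p.K).eta (k + 1) ^ 2 + Δ)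
    (hBA : ∀ c : Iχ F ν p g k, ∀ q ∈ plaqInside (cubeEnl (F.P p.K) (sideχ F ν p g k) c 1), ∃ q' ∈ plaqInside (cubeEnl (F.P p'.K) (sideχ F ν p' g' k') (ι c) 1),
      dist1 (plaqHol (ukBox (bgOfRecord (avOfRecord F N p.K) {U | PlaqSmall (ν.εreg * (F.P p.K).eta (k + 1) ^ 2) U}) ν.M₁
          (cubeEnl (F.P p.K) (sideχ F ν p g k) c 4) (k + 1) V) q) / (F.P p.K).eta (k + 1) ^ 2 ≤
        dist1 (plaqHol (ukBox (bgOfRecord (avOfRecord F N p'.K) {U | PlaqSmall (ν.εreg * (F.P p'.K).eta (k' + 1) ^ 2) U}) ν.M₁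
          (cubeEnl (F.P p'.K) (sideχ F ν p' g' k') (ι c) 4) (k' + 1) V') q') / (F.P p'.K).eta (k' + 1) ^ 2 + Δ)
    {θlo θ θhi : ℝ} (hlo : θlo + Δ ≤ θ) (hhi : θ + Δ ≤ θhi) (s : SeqOfRecord F ν M g p.K k) {Pl : Finset (Iχ F ν p g k)} (hP : Pl ⊆ cubes32 F ν M p g k s) :
    aWeightAt F N ν M p g k θ s Pl V -
        (∏ c ∈ cubes32 F ν M p g k s \ Pl, (chiFactorAt F N ν p g k θ c V * chiFactorAt F N ν p' g' k' θ (ι c) V')) *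
          ∏ c ∈ Pl, ((1 - chiFactorAt F N ν p g k θ c V) * (1 - chiFactorAt F N ν p' g' k' θ (ι c) V')) ≤
      aWeightAt F N ν M p g k θ s Pl V - aGapAt F N ν M p g k θlo θhi s Pl V :=
  aWeightAt_sub_core_le_aWeightAt_sub_aGapAt_of_device F N ν M p g k s hP V (fun c θ' => chiFactorAt F N ν p' g' k' θ' (ι c) V')
    (fun c θ' => chiFactorAt_nonneg F N ν p' g' k' θ' (ι c) V') (fun c θ' => chiFactorAt_le_one F N ν p' g' k' θ' (ι c) V')
    (fun c _ _ h => chiFactorAt_mono F N ν p' g' k' h (ι c) V') (device_AB_of_bgClose F N ν ι V V' hAB) (device_BA_of_bgClose F N ν ι V V' hBA) hΔ hlo hhi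

/-- … and the gapped weight itself lies below the common-refinement core (same hypotheses). [bookkeeping] -/
theorem aGapAt_le_core_of_bgClose {p p' : B12.RunParams} {g g' : ℕ → ℝ} {k k' : ℕ} (ι : Iχ F ν p g k → Iχ F ν p' g' k')
    (V : GaugeField (F.P p.K) (k + 1) (SU N)) (V' : GaugeField (F.P p'.K) (k' + 1) (SU N)) {Δ : ℝ} (hΔ : 0 ≤ Δ)
    (hAB : ∀ c : Iχ F ν p g k, ∀ q' ∈ plaqInside (cubeEnl (F.P p'.K) (sideχ F ν p' g' k') (ι c) 1), ∃ q ∈ plaqInside (cubeEnl (F.P p.K) (sideχ F ν p g k) c 1),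
      dist1 (plaqHol (ukBox (bgOfRecord (avOfRecord F N p'.K) {U | PlaqSmall (ν.εreg * (F.P p'.K).eta (k' + 1) ^ 2) U}) ν.M₁
          (cubeEnl (F.P p'.K) (sideχ F ν p' g' k') (ι c) 4) (k' + 1) V') q') / (F.P p'.K).eta (k' + 1) ^ 2 ≤
        dist1 (plaqHol (ukBox (bgOfRecord (avOfRecord F N p.K) {U | PlaqSmall (ν.εreg * (F.P p.K).eta (k + 1) ^ 2) U}) ν.M₁
          (cubeEnl (F.P p.K) (sideχ F ν p g k) c 4) (k + 1) V) q) / (F.P p.K).eta (k + 1) ^ 2 + Δ)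
    (hBA : ∀ c : Iχ F ν p g k, ∀ q ∈ plaqInside (cubeEnl (F.P p.K) (sideχ F ν p g k) c 1), ∃ q' ∈ plaqInside (cubeEnl (F.P p'.K) (sideχ F ν p' g' k') (ι c) 1),
      dist1 (plaqHol (ukBox (bgOfRecord (avOfRecord F N p.K) {U | PlaqSmall (ν.εreg * (F.P p.K).eta (k + 1) ^ 2) U}) ν.M₁
          (cubeEnl (F.P p.K) (sideχ F ν p g k) c 4) (k + 1) V) q) / (F.P p.K).eta (k + 1) ^ 2 ≤
        dist1 (plaqHol (ukBox (bgOfRecord (avOfRecord F N p'.K) {U | PlaqSmall (ν.εreg * (F.P p'.K).eta (k' + 1) ^ 2) U}) ν.M₁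
          (cubeEnl (F.P p'.K) (sideχ F ν p' g' k') (ι c) 4) (k' + 1) V') q') / (F.P p'.K).eta (k' + 1) ^ 2 + Δ)
    {θlo θ θhi : ℝ} (hlo : θlo + Δ ≤ θ) (hhi : θ + Δ ≤ θhi) (s : SeqOfRecord F ν M g p.K k) {Pl : Finset (Iχ F ν p g k)} (hP : Pl ⊆ cubes32 F ν M p g k s) :
    aGapAt F N ν M p g k θlo θhi s Pl V ≤
      (∏ c ∈ cubes32 F ν M p g k s \ Pl, (chiFactorAt F N ν p g k θ c V * chiFactorAt F N ν p' g' k' θ (ι c) V')) *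
        ∏ c ∈ Pl, ((1 - chiFactorAt F N ν p g k θ c V) * (1 - chiFactorAt F N ν p' g' k' θ (ι c) V')) :=
  aGapAt_le_core_of_device F N ν M p g k s hP V (fun c θ' => chiFactorAt F N ν p' g' k' θ' (ι c) V')
    (fun c θ' => chiFactorAt_nonneg F N ν p' g' k' θ' (ι c) V') (fun c θ' => chiFactorAt_le_one F N ν p' g' k' θ' (ι c) V')
    (fun c _ _ h => chiFactorAt_mono F N ν p' g' k' h (ι c) V') (device_AB_of_bgClose F N ν ι V V' hAB) (device_BA_of_bgClose F N ν ι V V' hBA) hΔ hlo hhi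

end Junction

/-! ## §3b On the support of run A's GAPPED weight the two runs' top (3.2) factors AGREE (the «identical indicator sets» premise of the core sandwich) -/

section Support

open Summit.QuantumFields.YangMills.Theorems.N21ShellSplitOfRecord13CoPH (aGapAt aGapAt_of_subset)
open scoped BigOperators

/-- In a finite product of reals in `[0,1]` that is `≥ 1`, every factor equals `1`. [folklore] -/
theorem eq_one_of_prod_ge_one {ι : Type*} (s : Finset ι) {f : ι → ℝ} (h0 : ∀ i ∈ s, 0 ≤ f i) (h1 : ∀ i ∈ s, f i ≤ 1) (h : 1 ≤ ∏ i ∈ s, f i) :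
    ∀ i ∈ s, f i = 1 := by
  classical
  intro i hi
  have hsplit := Finset.mul_prod_erase s f hi
  have hrest : ∏ j ∈ s.erase i, f j ≤ 1 := Finset.prod_le_one (fun j hj => h0 j (Finset.mem_of_mem_erase hj)) fun j hj => h1 j (Finset.mem_of_mem_erase hj)
  have hrest0 : 0 ≤ ∏ j ∈ s.erase i, f j := Finset.prod_nonneg fun j hj => h0 j (Finset.mem_of_mem_erase hj)
  have hle : ∏ j ∈ s, f j ≤ f i := by
    rw [← hsplit]; exact mul_le_of_le_one_right (h0 i hi) hrest
  exact le_antisymm (h1 i hi) (h.trans hle)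

variable (F : T4Family) (N : ℕ) [NeZero N] (ν : Stage7Numerics) (M : ℕ)

/-- ★★ **ON THE GAPPED SUPPORT THE RUNS' TOP INDICATORS AGREE.**  Under the hypotheses of `aGapAt_le_core_of_bgClose` (two-way background closeness through `ι`, collar clearing `Δ`):
wherever run A's GAPPED (3.2) weight of the label `P` does not vanish (`aGapAt θlo θhi s P V ≠ 0`, i.e. `= 1`), run B's (3.2) factors at the common letter `θ` read through `ι` take
EXACTLY run A's values at `θ`: `χf^B_θ(ι c)(V′) = 1 = χf^A_θ(c)(V)` off `P` and `χf^B_θ(ι c)(V′) = 0 = χf^A_θ(c)(V)` on `P` — the «identical indicator sets» on which N19′'s core sandwich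
compares the slot densities (NE7 proper, NOT here). [bookkeeping] -/
theorem top_factors_agree_on_gapped_support {p p' : B12.RunParams} {g g' : ℕ → ℝ} {k k' : ℕ} (ι : Iχ F ν p g k → Iχ F ν p' g' k')
    (V : GaugeField (F.P p.K) (k + 1) (SU N)) (V' : GaugeField (F.P p'.K) (k' + 1) (SU N)) {Δ : ℝ} (hΔ : 0 ≤ Δ)
    (hAB : ∀ c : Iχ F ν p g k, ∀ q' ∈ plaqInside (cubeEnl (F.P p'.K) (sideχ F ν p' g' k') (ι c) 1), ∃ q ∈ plaqInside (cubeEnl (F.P p.K) (sideχ F ν p g k) c 1),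
      dist1 (plaqHol (ukBox (bgOfRecord (avOfRecord F N p'.K) {U | PlaqSmall (ν.εreg * (F.P p'.K).eta (k' + 1) ^ 2) U}) ν.M₁
          (cubeEnl (F.P p'.K) (sideχ F ν p' g' k') (ι c) 4) (k' + 1) V') q') / (F.P p'.K).eta (k' + 1) ^ 2 ≤
        dist1 (plaqHol (ukBox (bgOfRecord (avOfRecord F N p.K) {U | PlaqSmall (ν.εreg * (F.P p.K).eta (k + 1) ^ 2) U}) ν.M₁
          (cubeEnl (F.P p.K) (sideχ F ν p g k) c 4) (k + 1) V) q) / (F.P p.K).eta (k + 1) ^ 2 + Δ)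
    (hBA : ∀ c : Iχ F ν p g k, ∀ q ∈ plaqInside (cubeEnl (F.P p.K) (sideχ F ν p g k) c 1), ∃ q' ∈ plaqInside (cubeEnl (F.P p'.K) (sideχ F ν p' g' k') (ι c) 1),
      dist1 (plaqHol (ukBox (bgOfRecord (avOfRecord F N p.K) {U | PlaqSmall (ν.εreg * (F.P p.K).eta (k + 1) ^ 2) U}) ν.M₁
          (cubeEnl (F.P p.K) (sideχ F ν p g k) c 4) (k + 1) V) q) / (F.P p.K).eta (k + 1) ^ 2 ≤
        dist1 (plaqHol (ukBox (bgOfRecord (avOfRecord F N p'.K) {U | PlaqSmall (ν.εreg * (F.P p'.K).eta (k' + 1) ^ 2) U}) ν.M₁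
          (cubeEnl (F.P p'.K) (sideχ F ν p' g' k') (ι c) 4) (k' + 1) V') q') / (F.P p'.K).eta (k' + 1) ^ 2 + Δ)
    {θlo θ θhi : ℝ} (hlo : θlo + Δ ≤ θ) (hhi : θ + Δ ≤ θhi) (s : SeqOfRecord F ν M g p.K k) {Pl : Finset (Iχ F ν p g k)} (hP : Pl ⊆ cubes32 F ν M p g k s)
    (hsupp : aGapAt F N ν M p g k θlo θhi s Pl V ≠ 0) :
    (∀ c ∈ cubes32 F ν M p g k s \ Pl, chiFactorAt F N ν p g k θ c V = 1 ∧ chiFactorAt F N ν p' g' k' θ (ι c) V' = 1) ∧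
      (∀ c ∈ Pl, chiFactorAt F N ν p g k θ c V = 0 ∧ chiFactorAt F N ν p' g' k' θ (ι c) V' = 0) := by
  -- the gapped weight is a product of `{0,1}` factors: nonzero means `= 1`
  have hprod := aGapAt_of_subset F N ν M p g k θlo θhi s hP V
  have hfac1 : ∀ c ∈ cubes32 F ν M p g k s \ Pl, chiFactorAt F N ν p g k θlo c V = 1 := by
    intro c hc
    rcases N21ShellSplitOfRecord13CoPH.eq_zero_or_one_of_mul_self (chiFactorAt_mul_self F N ν p g k θlo c V) with h | h
    · exact absurd (by rw [hprod, Finset.prod_eq_zero hc h, zero_mul]) hsupp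
    · exact h
  have hfac2 : ∀ c ∈ Pl, chiFactorAt F N ν p g k θhi c V = 0 := by
    intro c hc
    rcases N21ShellSplitOfRecord13CoPH.eq_zero_or_one_of_mul_self (chiFactorAt_mul_self F N ν p g k θhi c V) with h | h
    · exact h
    · exact absurd (by rw [hprod, Finset.prod_eq_zero hc (by rw [h, sub_self]), mul_zero]) hsupp
  have hgap1 : aGapAt F N ν M p g k θlo θhi s Pl V = 1 := by
    rw [hprod, Finset.prod_eq_one fun c hc => hfac1 c hc, Finset.prod_eq_one fun c hc => by rw [hfac2 c hc, sub_zero], one_mul]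
  have hcore := aGapAt_le_core_of_bgClose F N ν M ι V V' hΔ hAB hBA hlo hhi s hP
  rw [hgap1] at hcore
  -- split `1 ≤ X * Y` with `X, Y ∈ [0,1]` into `X = 1`, `Y = 1`, then factor by factor
  have hX0 : 0 ≤ ∏ c ∈ cubes32 F ν M p g k s \ Pl, (chiFactorAt F N ν p g k θ c V * chiFactorAt F N ν p' g' k' θ (ι c) V') :=
    Finset.prod_nonneg fun c _ => mul_nonneg (chiFactorAt_nonneg F N ν p g k θ c V) (chiFactorAt_nonneg F N ν p' g' k' θ (ι c) V')
  have hX1 : ∏ c ∈ cubes32 F ν M p g k s \ Pl, (chiFactorAt F N ν p g k θ c V * chiFactorAt F N ν p' g' k' θ (ι c) V') ≤ 1 :=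
    Finset.prod_le_one (fun c _ => mul_nonneg (chiFactorAt_nonneg F N ν p g k θ c V) (chiFactorAt_nonneg F N ν p' g' k' θ (ι c) V')) fun c _ =>
      mul_le_one₀ (chiFactorAt_le_one F N ν p g k θ c V) (chiFactorAt_nonneg F N ν p' g' k' θ (ι c) V') (chiFactorAt_le_one F N ν p' g' k' θ (ι c) V')
  have hY0 : 0 ≤ ∏ c ∈ Pl, ((1 - chiFactorAt F N ν p g k θ c V) * (1 - chiFactorAt F N ν p' g' k' θ (ι c) V')) :=
    Finset.prod_nonneg fun c _ => mul_nonneg (sub_nonneg.2 (chiFactorAt_le_one F N ν p g k θ c V)) (sub_nonneg.2 (chiFactorAt_le_one F N ν p' g' k' θ (ι c) V'))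
  have hY1 : ∏ c ∈ Pl, ((1 - chiFactorAt F N ν p g k θ c V) * (1 - chiFactorAt F N ν p' g' k' θ (ι c) V')) ≤ 1 :=
    Finset.prod_le_one (fun c _ => mul_nonneg (sub_nonneg.2 (chiFactorAt_le_one F N ν p g k θ c V)) (sub_nonneg.2 (chiFactorAt_le_one F N ν p' g' k' θ (ι c) V'))) fun c _ =>
      mul_le_one₀ (sub_le_self _ (chiFactorAt_nonneg F N ν p g k θ c V)) (sub_nonneg.2 (chiFactorAt_le_one F N ν p' g' k' θ (ι c) V'))
        (sub_le_self _ (chiFactorAt_nonneg F N ν p' g' k' θ (ι c) V'))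
  have hX : 1 ≤ ∏ c ∈ cubes32 F ν M p g k s \ Pl, (chiFactorAt F N ν p g k θ c V * chiFactorAt F N ν p' g' k' θ (ι c) V') := by nlinarith
  have hY : 1 ≤ ∏ c ∈ Pl, ((1 - chiFactorAt F N ν p g k θ c V) * (1 - chiFactorAt F N ν p' g' k' θ (ι c) V')) := by nlinarith
  have hXc := eq_one_of_prod_ge_one _ (fun c _ => mul_nonneg (chiFactorAt_nonneg F N ν p g k θ c V) (chiFactorAt_nonneg F N ν p' g' k' θ (ι c) V'))
    (fun c _ => mul_le_one₀ (chiFactorAt_le_one F N ν p g k θ c V) (chiFactorAt_nonneg F N ν p' g' k' θ (ι c) V') (chiFactorAt_le_one F N ν p' g' k' θ (ι c) V')) hX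
  have hYc := eq_one_of_prod_ge_one _ (fun c _ => mul_nonneg (sub_nonneg.2 (chiFactorAt_le_one F N ν p g k θ c V)) (sub_nonneg.2 (chiFactorAt_le_one F N ν p' g' k' θ (ι c) V')))
    (fun c _ => mul_le_one₀ (sub_le_self _ (chiFactorAt_nonneg F N ν p g k θ c V)) (sub_nonneg.2 (chiFactorAt_le_one F N ν p' g' k' θ (ι c) V'))
      (sub_le_self _ (chiFactorAt_nonneg F N ν p' g' k' θ (ι c) V'))) hY
  refine ⟨fun c hc => ?_, fun c hc => ?_⟩
  · have h := hXc c hc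
    have ha1 := chiFactorAt_le_one F N ν p g k θ c V
    have hb1 := chiFactorAt_le_one F N ν p' g' k' θ (ι c) V'
    have ha0 := chiFactorAt_nonneg F N ν p g k θ c V
    have hb0 := chiFactorAt_nonneg F N ν p' g' k' θ (ι c) V'
    constructor <;> nlinarith
  · have h := hYc c hc
    have ha1 := chiFactorAt_le_one F N ν p g k θ c V
    have hb1 := chiFactorAt_le_one F N ν p' g' k' θ (ι c) V'
    have ha0 := chiFactorAt_nonneg F N ν p g k θ c V
    have hb0 := chiFactorAt_nonneg F N ν p' g' k' θ (ι c) V'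
    constructor <;> nlinarith

end Support


/-! ## §4 At dag-n21-d's SELECTED DEPTH `i⋆ = selGapDepth₁₃ … ≤ n_K`: the collar of the gapped reading clears a closeness `ε δ` and stays in the factor-two window -/

section AtSelectedDepth

open Summit.QuantumFields.YangMills.Theorems.N21ShellSplitOfRecord13CoPH (cutGrid selGapDepth₁₃ selGapDepth₁₃_le)
open Summit.QuantumFields.YangMills.Theorems.N21GappedTopCutDials (collar_rows_of_dials)
open YMDAG.UVSplit (histA₁₃ histB₁₃)

variable {F : T4Family} {N : ℕ} [NeZero N]

/-- ★★ **RUN A AT THE SELECTED DEPTH OF dag-n21-d's GAPPED READING** (`crGap₁₃VAt`'s letters, U5 p620791): with `i⋆ := selGapDepth₁₃ θ hP K₀ g₀ os ρ (n K) K t ≤ n K` (`selGapDepth₁₃_le`) and the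
dials' rows at `K`, the three letters `cutGrid θ.ν (histA₁₃ θ K₀ g₀ K) (K₀+K) (ρ K) (i⋆+2 ∕ i⋆+1 ∕ i⋆)` of `gapShellA₁₃` clear `ε_{K₀+K} δ` on both sides and lie in `[ε/2, ε]`. [bookkeeping] -/
theorem collar_rows_at_selGapDepth_A (θ : Stage13HParams F N) (hP : θ.Provisos₁₃CoPH F N) (K₀ : ℕ) (g₀ : ℕ → ℝ) (os : List (ULoop F)) (ρ : ℕ → ℝ) (n : ℕ → ℕ) (K : ℕ) (t : ℝ)
    {δ : ℝ} (hε : 0 ≤ epsOfRecord θ.ν (histA₁₃ θ K₀ g₀ K) (K₀ + K)) (hρ0 : 0 ≤ ρ K) (hρ1 : ρ K ≤ 1) (hhalf : (1 : ℝ) / 2 ≤ (1 - ρ K) ^ (n K + 2))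
    (hcompat : ∀ j, j ≤ n K + 2 → δ ≤ (1 - ρ K) ^ j * ρ K) :
    cutGrid θ.ν (histA₁₃ θ K₀ g₀ K) (K₀ + K) (ρ K) (selGapDepth₁₃ θ hP K₀ g₀ os ρ (n K) K t + 2) + epsOfRecord θ.ν (histA₁₃ θ K₀ g₀ K) (K₀ + K) * δ ≤
        cutGrid θ.ν (histA₁₃ θ K₀ g₀ K) (K₀ + K) (ρ K) (selGapDepth₁₃ θ hP K₀ g₀ os ρ (n K) K t + 1) ∧
      cutGrid θ.ν (histA₁₃ θ K₀ g₀ K) (K₀ + K) (ρ K) (selGapDepth₁₃ θ hP K₀ g₀ os ρ (n K) K t + 1) + epsOfRecord θ.ν (histA₁₃ θ K₀ g₀ K) (K₀ + K) * δ ≤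
        cutGrid θ.ν (histA₁₃ θ K₀ g₀ K) (K₀ + K) (ρ K) (selGapDepth₁₃ θ hP K₀ g₀ os ρ (n K) K t) ∧
      epsOfRecord θ.ν (histA₁₃ θ K₀ g₀ K) (K₀ + K) / 2 ≤ cutGrid θ.ν (histA₁₃ θ K₀ g₀ K) (K₀ + K) (ρ K) (selGapDepth₁₃ θ hP K₀ g₀ os ρ (n K) K t + 2) ∧
      cutGrid θ.ν (histA₁₃ θ K₀ g₀ K) (K₀ + K) (ρ K) (selGapDepth₁₃ θ hP K₀ g₀ os ρ (n K) K t) ≤ epsOfRecord θ.ν (histA₁₃ θ K₀ g₀ K) (K₀ + K) :=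
  collar_rows_of_dials θ.ν (histA₁₃ θ K₀ g₀ K) (K₀ + K) hε hρ0 hρ1 hhalf hcompat (selGapDepth₁₃_le θ hP K₀ g₀ os ρ (n K) K t)

/-- ★★ **RUN B AT THE SAME SELECTED DEPTH** (top level `K₀ + K + 1`, history `histB₁₃`; the letters of `gapShellB₁₃`). [bookkeeping] -/
theorem collar_rows_at_selGapDepth_B (θ : Stage13HParams F N) (hP : θ.Provisos₁₃CoPH F N) (K₀ : ℕ) (g₀ : ℕ → ℝ) (os : List (ULoop F)) (ρ : ℕ → ℝ) (n : ℕ → ℕ) (K : ℕ) (t : ℝ)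
    {δ : ℝ} (hε : 0 ≤ epsOfRecord θ.ν (histB₁₃ θ K₀ g₀ K) (K₀ + K + 1)) (hρ0 : 0 ≤ ρ K) (hρ1 : ρ K ≤ 1) (hhalf : (1 : ℝ) / 2 ≤ (1 - ρ K) ^ (n K + 2))
    (hcompat : ∀ j, j ≤ n K + 2 → δ ≤ (1 - ρ K) ^ j * ρ K) :
    cutGrid θ.ν (histB₁₃ θ K₀ g₀ K) (K₀ + K + 1) (ρ K) (selGapDepth₁₃ θ hP K₀ g₀ os ρ (n K) K t + 2) + epsOfRecord θ.ν (histB₁₃ θ K₀ g₀ K) (K₀ + K + 1) * δ ≤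
        cutGrid θ.ν (histB₁₃ θ K₀ g₀ K) (K₀ + K + 1) (ρ K) (selGapDepth₁₃ θ hP K₀ g₀ os ρ (n K) K t + 1) ∧
      cutGrid θ.ν (histB₁₃ θ K₀ g₀ K) (K₀ + K + 1) (ρ K) (selGapDepth₁₃ θ hP K₀ g₀ os ρ (n K) K t + 1) + epsOfRecord θ.ν (histB₁₃ θ K₀ g₀ K) (K₀ + K + 1) * δ ≤
        cutGrid θ.ν (histB₁₃ θ K₀ g₀ K) (K₀ + K + 1) (ρ K) (selGapDepth₁₃ θ hP K₀ g₀ os ρ (n K) K t) ∧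
      epsOfRecord θ.ν (histB₁₃ θ K₀ g₀ K) (K₀ + K + 1) / 2 ≤ cutGrid θ.ν (histB₁₃ θ K₀ g₀ K) (K₀ + K + 1) (ρ K) (selGapDepth₁₃ θ hP K₀ g₀ os ρ (n K) K t + 2) ∧
      cutGrid θ.ν (histB₁₃ θ K₀ g₀ K) (K₀ + K + 1) (ρ K) (selGapDepth₁₃ θ hP K₀ g₀ os ρ (n K) K t) ≤ epsOfRecord θ.ν (histB₁₃ θ K₀ g₀ K) (K₀ + K + 1) :=
  collar_rows_of_dials θ.ν (histB₁₃ θ K₀ g₀ K) (K₀ + K + 1) hε hρ0 hρ1 hhalf hcompat (selGapDepth₁₃_le θ hP K₀ g₀ os ρ (n K) K t)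

end AtSelectedDepth



end Summit.QuantumFields.YangMills.Theorems.N21TwoRunDevice
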